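import Mathlib
import Literature.NumberTheory.LFunctions.Zhang2022.SkeletonProp22W
import Literature.NumberTheory.LFunctions.Zhang2022.Section5Lemma59Ded
import HarnessLib

/-!
# Zhang (2022), typed skeleton XX: Lemma 5.9 on the height range its uses need (`𝓛₁ + 1/4`) and
# the proof node of Lemma 8.1 re-pointed to it

Topic `Literature/NumberTheory/LFunctions/Zhang2022` (Landau–Siegel audit tree; verdict-neutral).
Y. Zhang, *Discrete mean estimates and the Landau–Siegel zero*, arXiv:2211.02515v1 (2022)
[Zhang2022LandauSiegel] — **an unrefereed manuscript under adjudication; every `def … : Prop`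
below is a CLAIM NODE, STATED NOT ASSERTED** (a named hypothesis of the whole-DAG theorem).

Why this file exists (campaign D-0069, gap row G-d14-1, discharger sz-d14's kernel result
`Skeleton.lemma59A_restricted_of_prop22`): Lemma 5.9 is printed for `|t − 2πt₀| ≤ 𝓛₁ + 10`, but
its proof rests on Proposition 2.2, which controls zeros only in `Ω` (`|t − 2πt₀| < 𝓛₁ + 2`) — the
printed range is not derivable, while every use site (the rectangles of §8, heights `≤ 𝓛₁ + Cα`)
needs only `≤ 𝓛₁ + 1/4`, where sz-d14 PROVED it from `Prop22 c′` (`c′ ≥ 0`). This file banks the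
use-range node `Lemma59AR c′` (the (A)-form `Lemma59A` of `SkeletonBlanketA` verbatim with
`𝓛₁ + 10 ↦ 𝓛₁ + 1/4` — literally the conclusion of `lemma59A_restricted_of_prop22`), the proof node
of Lemma 8.1 re-pointed to it (`Ded81V c′ := Prop22W → Lemma33b → Lemma52 → Lemma59AR → Lemma61A →
Lemma81`), the comparison edges, and the kernel discharge `lemma59AR_of_prop22` (sz-d14's theorem
under this name's type). A discharge from the WINDOWED `Prop22W` (the node of record since
`SkeletonProp22W`) is what lets the leaf drop out of the whole DAG; it is requested from sz-d14.

What is NOT asserted: Lemma 5.9 in any form beyond what is proved here from `Prop22`. Nothing here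
bears on Theorems 1–2 of the source.

## References

* Y. Zhang, arXiv:2211.02515v1 (2022), §5 Lemma 5.9 (p. 11), §8 p. 16 (proof of Lemma 8.1).
  [cite: Zhang2022LandauSiegel, §5 Lemma 5.9]
-/

noncomputable section

open Complex Real

namespace Literature.NumberTheory.LFunctions.Zhang2022.Skeleton

variable (c' : ℝ)

/-- **Lemma 5.9, (A)-form, on the use-range `|t − 2πt₀| ≤ 𝓛₁ + 1/4`** (gap row G-d14-1): the node
`Lemma59A c′` verbatim with `ell1 D + 10 ↦ ell1 D + 1/4`. CLAIM, stated not asserted — and DERIVED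
in the kernel from `Prop22 c′` for `c′ ≥ 0` (`lemma59AR_of_prop22`, sz-d14).
[cite: Zhang2022LandauSiegel, §5 Lemma 5.9] -/
def Lemma59AR : Prop :=
  ∀ c₀ : ℝ, 0 < c₀ → ∃ C : ℝ, ForAllLarge fun D _ χ => AssumptionA D χ → ∀ x ∈ PsiOne χ, ∀ s : ℂ,
    |s.re - 1 / 2| ≤ alpha D → |s.im - 2 * π * t0 D| ≤ ell1 D + 1 / 4 →
      (∀ ρ : ℂ, x.ψ.LFunction ρ = 0 → c₀ * alpha D ≤ ‖s - ρ‖) →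
        ‖x.ψ.LFunction (s + beta1 c' D) / x.ψ.LFunction s‖ ≤ C * Real.log (bigP D)

/-- **§8 p. 16, the proof of Lemma 8.1, inputs of record**: `Prop22W c′ → Lemma33b → Lemma52 c′ →
Lemma59AR c′ → Lemma61A → Lemma81 c′` (Proposition 2.2 windowed, Lemma 5.9 on its use-range, Lemma
6.1 in the (A)-form). CLAIM. [cite: Zhang2022LandauSiegel, §8 p. 16] -/
def Ded81V : Prop := Prop22W c' → Lemma33b → Lemma52 c' → Lemma59AR c' → Lemma61A → Lemma81 c'

/-- `Lemma59A c′` (range `𝓛₁ + 10`) implies `Lemma59AR c′` (range `𝓛₁ + 1/4`).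
[cite: Zhang2022LandauSiegel, §5 Lemma 5.9] -/
theorem lemma59AR_of_lemma59A {c' : ℝ} (h : Lemma59A c') : Lemma59AR c' := by
  intro c₀ hc₀
  obtain ⟨C, hC⟩ := h c₀ hc₀
  exact ⟨C, hC.mono fun D _ χ _ _ hS hA x hx s h1 h2 h3 =>
    hS hA x hx s h1 (le_trans h2 (by norm_num)) h3⟩

/-- **Lemma 5.9 on its use-range is a consequence of Proposition 2.2** (sz-d14,
`Section5Lemma59Ded`), for every `c′ ≥ 0`. [cite: Zhang2022LandauSiegel, §5 Lemma 5.9] -/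
theorem lemma59AR_of_prop22 {c' : ℝ} (hc' : 0 ≤ c') (h22 : Prop22 c') : Lemma59AR c' :=
  lemma59A_restricted_of_prop22 hc' h22

/-- `Ded81V` (Lemma 8.1 from the weaker `Lemma59AR`) implies `Ded81W`.
[cite: Zhang2022LandauSiegel, §8 p. 16] -/
theorem ded81W_of_ded81V {c' : ℝ} (h : Ded81V c') : Ded81W c' :=
  fun h22 h33b h52 h59 h61 => h h22 h33b h52 (lemma59AR_of_lemma59A h59) h61

end Literature.NumberTheory.LFunctions.Zhang2022.Skeleton
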